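import Literature.NumberTheory.Automorphic.Liu2021.Def411WeilCarriersLineClassDictionary
import Literature.NumberTheory.Automorphic.Liu2021.LocalNormClassFlip
import HarnessLib

/-!
# [Liu2021, Lem. D.1 (4)] at `n = 2`, non-split place: the letter's class hypotheses put `a′` in the class of `(−t₀t₁)·a`

Topic `NumberTheory/Automorphic/Liu2021`; namespace `Literature.NumberTheory.Automorphic.Liu2021.Def411WeilCarriers` (home of ★ `locF`, `epsLine`,
`sameClass_epsLine_iff_locF_apply_eq`).  KERNEL ONLY: theorems; no definition, no named fact, no `sorry`.  Cell `hodgecm-mathlib` (D-0151), programme P5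
(crux HLiu418 = stmt-HodgeConjecture-24832), piece **(C5)** of the road card `F0/P5/A-p18/g23/ROAD-L4if-v3.A-p18g23.md` §8 (A-p18 (g23), 2026-09-01).

THE MATHEMATICS ([Liu2021, App. D Lemma D.1 (4), l. 5235]; [Omeara1963, §63B]: `F_v^×/Nm E_v^×` has order `2` at a place where `d` is not a square).  For the plane
`V_v = (E_v², diag(t₀,t₁) ⊗ 1)` and two lines `a, a′ ∈ F^×` with Step-1 representatives `ε = (aδ) ⊗ 1`, `ε′ = (a′δ) ⊗ 1`: the letter's hypotheses
«`V_v` isotropic ⇒ `ε′ ~ ε`» and «`V_v` anisotropic ⇒ `ε′ ≁ ε`» imply, in BOTH cases, **`ε′ ~` the representative of the line `(−t₀t₁)·a`**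
(`sameClass_epsLine_neg_det_mul`): `V_v` is isotropic iff `(d, −t₀t₁)_v = 1` (★ `isIsotropic_standingData_iff_hilbertSymbol_eq_one`) iff the class of
`−t₀t₁` is trivial; in the anisotropic case the two non-trivial conditions coincide in the group of order `2` (★ `natCard_normClassGroup_eq_two`).  This is the
line bookkeeping that lets the in-house transport identity «`Θ_χ(λ′, −(det T_V)·a) ≅ Θ_χ(λ, a)`» (★ (C4b) + B2) meet the letter's member `(λ′, a′)` through the
line transport of ★ `LocalLineIsometryNaturality` (same class ⇒ isomorphic theta types).
Nothing of the cited sources is asserted; HC_CM is proved only modulo the printed citations until rung 0 closes.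

## References
* [Liu2021] Y. Liu, App. D §D.1 Step 1 (l. 5217), Lemma D.1 (4) (l. 5235); Def. 4.12 (l. 2105).
* [Omeara1963] O. T. O'Meara, Introduction to Quadratic Forms (1963), §63B Cor. 63:13a, §65A.
-/

set_option autoImplicit false

noncomputable section

open scoped Matrix NumberField
open NumberField IsDedekindDomain
open Literature.NumberTheory Literature.NumberTheory.Automorphic Literature.NumberTheory.Automorphic.UnitaryGroup
open Literature.RepresentationTheory
open Literature.NumberTheory.QuadraticForms (quadraticNormSubgroup hilbertSymbol hilbertSymbol_comm hilbertSymbol_eq_one_iff_mem_quadraticNormSubgroup)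

namespace Literature.NumberTheory.Automorphic.Liu2021.Def411WeilCarriers

/-! ## §1 A group of order two -/

/-- in a group of order `2`: if `c ≠ 1` and `y ≠ x` then `y = c · x`. [cite: Omeara1963, §63B Cor. 63:13a] -/
private theorem eq_mul_of_ne_of_card_eq_two {Q : Type*} [Group Q] (h : Nat.card Q = 2) {c x y : Q} (hc : c ≠ 1) (hxy : y ≠ x) : y = c * x := by
  obtain ⟨c', hc', huniq⟩ := (Nat.card_eq_two_iff' (1 : Q)).1 h
  have hcc' : c = c' := huniq c hc
  have key : ∀ z : Q, z = 1 ∨ z = c := fun z => by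
    by_cases hz : z = 1
    · exact Or.inl hz
    · exact Or.inr (hcc' ▸ huniq z hz)
  have hcc : c * c = 1 := by
    rcases key (c * c) with h1 | h2
    · exact h1
    · exact absurd (mul_left_cancel (a := c) (h2.trans (mul_one c).symm)) hc
  rcases key x with rfl | rfl <;> rcases key y with rfl | rfl
  · exact absurd rfl hxy
  · rw [mul_one]
  · rw [hcc]
  · exact absurd rfl hxy

/-! ## §2 The class bookkeeping of Lemma D.1 (4) at a place -/

section Place

variable (F E : Type) [Field F] [NumberField F] [Field E] [NumberField E] [Algebra F E] (c : E ≃ₐ[F] E)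
  [Algebra.IsQuadraticExtension F E] {δ : E} (hcδ : c δ = -δ) (hδ : δ ≠ 0) {d : F} (hd : δ * δ = algebraMap F E d)
  (v : HeightOneSpectrum (𝓞 F)) (t : Fin 2 → F) (ht : ∀ i, t i ≠ 0)
  {J : Matrix (Fin 2) (Fin 2) E} (hJ : J = (Matrix.diagonal t).map (algebraMap F E)) (hJh : (J.map c)ᵀ = J) (hJdet : J.det ≠ 0)

omit [NumberField F] in
/-- the unit `−t₀t₁ ∈ F^×` (minus the determinant of the frame). [cite: Liu2021, App. D Lemma D.1 (4) (l. 5235)] -/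
private theorem coe_negDet : ((-(Units.mk0 (t 0 * t 1) (mul_ne_zero (ht 0) (ht 1))) : Fˣ) : F) = -(t 0 * t 1) := by
  rw [Units.val_neg, Units.val_mk0]

include hcδ hδ hd hJ hJh hJdet ht in
/-- **the class of `−t₀t₁` at `v` is trivial iff `V_v` is isotropic** (`(d, −t₀t₁)_v = 1`, ★ `isIsotropic_standingData_iff_hilbertSymbol_eq_one`, ★
`hilbertSymbol_eq_one_iff_mem_quadraticNormSubgroup`). [cite: Liu2021, App. D Lemma D.1 (4) (l. 5235)] [cite: Omeara1963, §63B Cor. 63:13a] -/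
theorem locF_negDet_apply_eq_one_iff :
    locF F d (-(Units.mk0 (t 0 * t 1) (mul_ne_zero (ht 0) (ht 1)))) v = 1 ↔
      LemD1.IsIsotropic (LemD1OfPlace.standingData E v c 2 J hcδ hδ le_rfl hJh hJdet) := by
  have hd0 : algebraMap F (v.adicCompletion F) d ≠ 0 := by
    intro h
    have : d = 0 := (map_eq_zero _).1 h
    rw [this, map_zero, mul_self_eq_zero] at hd
    exact hδ hd
  rw [LemD1OfPlace.isIsotropic_standingData_iff_hilbertSymbol_eq_one E v c hcδ hδ t hJ hJh hJdet hd ht, locF_apply, QuotientGroup.eq_one_iff,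
    hilbertSymbol_comm, ← hilbertSymbol_eq_one_iff_mem_quadraticNormSubgroup hd0]
  have hcoe : ((Units.map (algebraMap F (v.adicCompletion F)).toMonoidHom (-(Units.mk0 (t 0 * t 1) (mul_ne_zero (ht 0) (ht 1)))) :
      (v.adicCompletion F)ˣ) : v.adicCompletion F) = algebraMap F (v.adicCompletion F) (-(t 0 * t 1)) := by
    rw [Units.coe_map, coe_negDet F t ht]; rfl
  rw [hcoe]

include hcδ hδ hd hJ hJh hJdet ht in
/-- **[Liu2021, Lem. D.1 (4)], the line bookkeeping at a place, `n = 2`.**  If `ε′ ~ ε` when `V_v` is isotropic and `ε′ ≁ ε` when `V_v` is anisotropic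
(the letter's two class hypotheses for the Step-1 representatives of the lines `a, a′`), then **`ε′ ~` the representative of the line `(−t₀t₁)·a`** — in both
cases. [cite: Liu2021, App. D Lemma D.1 (4) (l. 5235); §D.1 Step 1 (l. 5217)] [cite: Omeara1963, §63B Cor. 63:13a] -/
theorem sameClass_epsLine_neg_det_mul (a a' : Fˣ)
    (hiso : LemD1.IsIsotropic (LemD1OfPlace.standingData E v c 2 J hcδ hδ le_rfl hJh hJdet) →
      LemD1.SameClass (S := LemD1OfPlace.standingData E v c 2 J hcδ hδ le_rfl hJh hJdet)
        ⟨epsLine E hδ a v, epsLine_mem_skew E c 2 J hcδ hδ le_rfl hJh hJdet a v⟩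
        ⟨epsLine E hδ a' v, epsLine_mem_skew E c 2 J hcδ hδ le_rfl hJh hJdet a' v⟩)
    (han : ¬ LemD1.IsIsotropic (LemD1OfPlace.standingData E v c 2 J hcδ hδ le_rfl hJh hJdet) →
      ¬ LemD1.SameClass (S := LemD1OfPlace.standingData E v c 2 J hcδ hδ le_rfl hJh hJdet)
        ⟨epsLine E hδ a v, epsLine_mem_skew E c 2 J hcδ hδ le_rfl hJh hJdet a v⟩
        ⟨epsLine E hδ a' v, epsLine_mem_skew E c 2 J hcδ hδ le_rfl hJh hJdet a' v⟩) :
    LemD1.SameClass (S := LemD1OfPlace.standingData E v c 2 J hcδ hδ le_rfl hJh hJdet)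
      ⟨epsLine E hδ (-(Units.mk0 (t 0 * t 1) (mul_ne_zero (ht 0) (ht 1))) * a) v,
        epsLine_mem_skew E c 2 J hcδ hδ le_rfl hJh hJdet (-(Units.mk0 (t 0 * t 1) (mul_ne_zero (ht 0) (ht 1))) * a) v⟩
      ⟨epsLine E hδ a' v, epsLine_mem_skew E c 2 J hcδ hδ le_rfl hJh hJdet a' v⟩ := by
  apply sameClass_epsLine_of_locF_apply_eq F E c 2 J hcδ hδ hd le_rfl hJh hJdet v
  -- goal: `locF ((−t₀t₁)·a) v = locF a′ v`
  rw [map_mul, Pi.mul_apply]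
  by_cases hI : LemD1.IsIsotropic (LemD1OfPlace.standingData E v c 2 J hcδ hδ le_rfl hJh hJdet)
  · -- isotropic: the class of `−t₀t₁` is trivial and `ε′ ~ ε`
    rw [(locF_negDet_apply_eq_one_iff F E c hcδ hδ hd v t ht hJ hJh hJdet).2 hI]
    exact (one_mul _).trans (locF_apply_eq_of_sameClass_epsLine F E c 2 J hcδ hδ hd le_rfl hJh hJdet v a a' (hiso hI))
  · -- anisotropic: `locF a′ ≠ locF a` and the class of `−t₀t₁` is the non-trivial element of a group of order two
    have hne : locF F d a' v ≠ locF F d a v := fun h =>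
      han hI (sameClass_epsLine_of_locF_apply_eq F E c 2 J hcδ hδ hd le_rfl hJh hJdet v a a' h.symm)
    have hc1 : locF F d (-(Units.mk0 (t 0 * t 1) (mul_ne_zero (ht 0) (ht 1)))) v ≠ 1 := fun h =>
      hI ((locF_negDet_apply_eq_one_iff F E c hcδ hδ hd v t ht hJ hJh hJdet).1 h)
    have h2 := RemD5.natCard_normClassGroup_eq_two v d (RemD5.not_isSquare_of_not_isIsotropic E v c hcδ hδ t hJ hJh hJdet hd ht hI)
    exact (eq_mul_of_ne_of_card_eq_two h2 hc1 hne).symm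

end Place

end Literature.NumberTheory.Automorphic.Liu2021.Def411WeilCarriers

end
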